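import Summits.AtomisticToContinuum.Crystallization.Theorems.FrustratedLawDichotomyStrainedPatchHomPolar
import Summits.AtomisticToContinuum.Crystallization.Theorems.FrustratedLawDichotomyStrainedPatchHomCoords

/-!
# SLAB CONFINEMENT from the Q-form: componentwise / isotropic bounds on the shuffle displacement and the transfer to ξ-coordinates
# (27623 `(H) HomFloor (1/625)`, hcp half; the «Q-form ring corollary» of critic row 1110 (1), real side)

decomp-a2c hand-1 g29 (crux `AperiodicFrustratedLawGap`, stmt-AtomisticToContinuum-27623).  The slab branch of the analytic-slab dichotomy
`…HomExemptZeroStep.slab_or_exempt_of_ring` reads `Q(Δ) ≤ t·‖Δ‖` with `Δ = U(ξ − ξ₀)`, `t = S₇♯(7) + f₀ + |R|·6⁻⁷` and `Q` the certified force-Jacobian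
form of `…HomCurvLJAnisoM.curvLJ_floorM_of_check` (`Q(x) = (lamS/SC)‖x‖² + Σ_ij (D_ij/SC) x_i x_j`).  The fit leaf needs a BOX around `ξ₀`.  Pure algebra:

* §1 ★ `abs_inner_le_of_qcert` / ★ `abs_apply_le_of_qcert` — if `t‖x‖² + tγ²·ℓ(x)² ≤ 2γr·Q(x)` for all `x` (a PSD certificate the kernel checks on an
  INTEGER matrix, `ℓ` = a linear functional or a coordinate) and `Q(Δ) ≤ t‖Δ‖`, then `|ℓ(Δ)| ≤ r` (AM–GM: `2γ|ℓ(Δ)|‖Δ‖ ≤ ‖Δ‖² + γ²ℓ(Δ)²`; minimising over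
  `γ` this is the sharp `r = t·max_{‖u‖=1} ℓ(u)‖u‖/Q(u)`-type confinement of the CLAM memo, e.g. `|Δ_c| ≤ 1.16·10⁻³` at the corner cell);
  ★ `norm_le_of_qfloor` — isotropic: `λ‖x‖² ≤ Q(x)`, `λ > 0` ⟹ `‖Δ‖ ≤ t/λ`;
* §2 ★ `abs_coord_sub_le_of_near_one` — transfer to ξ-coordinates: for ANY `V` (the kernel's rational approximate inverse of the cell's `U`),
  `|(ξ − ξ₀)_k − (V Δ)_k| ≤ ‖1 − V∘U‖·(4/3)‖Δ‖` (`‖U − 1‖ ≤ 1/4`), and ★ `abs_coord_le_of_box` — `|(ξ − ξ₀)_k| ≤ Σ_j |V_kj|·r_j + ‖1 − V∘U‖·(4/3)·ρ` from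
  `|Δ_j| ≤ r_j`, `‖Δ‖ ≤ ρ`: the confined ξ-box the fit leaf is run on.

NO definitions; 0 sorry; standard axioms; no instances / notation / `#eval`.  `--supports stmt-AtomisticToContinuum-27623`.
-/

namespace Summit.AtomisticToContinuum.Crystallization.Theorems.FrustratedLawDichotomyStrainedPatchHomSlabConfine

open scoped BigOperators RealInnerProductSpace
open Summit.AtomisticToContinuum.Crystallization.Theorems.ChargedEnergyGapNegative (E3)
open Summit.AtomisticToContinuum.Crystallization.Theorems.FrustratedLawDichotomyStrainedPatchHomPolar (norm_apply_ge_of_norm_sub_one_le)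
open Summit.AtomisticToContinuum.Crystallization.Theorems.FrustratedLawDichotomyStrainedPatchHomCoords (coord_mem_cube_of_norm_le apply_eq_sum_entries)

/-! ## §1. Confinement from a certified quadratic form -/

/-- ★ **FUNCTIONAL CONFINEMENT FROM A PSD CERTIFICATE**: `0 < t`, `0 < γ`, `0 ≤ r`, `t‖x‖² + tγ²⟪v, x⟫² ≤ 2γr·Q(x)` for all `x`, and `Q(Δ) ≤ t‖Δ‖`
give `|⟪v, Δ⟫| ≤ r`. [folklore: AM–GM] -/
theorem abs_inner_le_of_qcert {Q : E3 → ℝ} {t γ r : ℝ} (ht : 0 < t) (hγ : 0 < γ) (hr : 0 ≤ r) (v : E3)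
    (hcert : ∀ x : E3, t * ‖x‖ ^ 2 + t * γ ^ 2 * ⟪v, x⟫ ^ 2 ≤ 2 * γ * r * Q x) {Δ : E3} (hΔ : Q Δ ≤ t * ‖Δ‖) :
    |⟪v, Δ⟫| ≤ r := by
  by_cases h0 : Δ = 0
  · rw [h0, inner_zero_right, abs_zero]; exact hr
  have hpos : 0 < ‖Δ‖ := norm_pos_iff.2 h0
  have h1 := hcert Δ
  have h2 : 2 * γ * r * Q Δ ≤ 2 * γ * r * (t * ‖Δ‖) := mul_le_mul_of_nonneg_left hΔ (by positivity)
  have h3 : 2 * γ * (|⟪v, Δ⟫| * ‖Δ‖) ≤ ‖Δ‖ ^ 2 + γ ^ 2 * ⟪v, Δ⟫ ^ 2 := by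
    nlinarith [sq_nonneg (‖Δ‖ - γ * |⟪v, Δ⟫|), sq_abs ⟪v, Δ⟫]
  have h4 : (2 * γ * t * ‖Δ‖) * |⟪v, Δ⟫| ≤ (2 * γ * t * ‖Δ‖) * r := by nlinarith [abs_nonneg ⟪v, Δ⟫]
  exact le_of_mul_le_mul_left h4 (by positivity)

/-- ★ **COORDINATE CONFINEMENT FROM A PSD CERTIFICATE**: `0 < t`, `0 < γ`, `0 ≤ r`, `t‖x‖² + tγ²x_k² ≤ 2γr·Q(x)` for all `x`, and `Q(Δ) ≤ t‖Δ‖`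
give `|Δ_k| ≤ r`. [folklore: AM–GM] -/
theorem abs_apply_le_of_qcert {Q : E3 → ℝ} {t γ r : ℝ} (ht : 0 < t) (hγ : 0 < γ) (hr : 0 ≤ r) (k : Fin 3)
    (hcert : ∀ x : E3, t * ‖x‖ ^ 2 + t * γ ^ 2 * (x k) ^ 2 ≤ 2 * γ * r * Q x) {Δ : E3} (hΔ : Q Δ ≤ t * ‖Δ‖) :
    |Δ k| ≤ r := by
  by_cases h0 : Δ = 0
  · rw [h0]; simpa using hr
  have hpos : 0 < ‖Δ‖ := norm_pos_iff.2 h0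
  have h1 := hcert Δ
  have h2 : 2 * γ * r * Q Δ ≤ 2 * γ * r * (t * ‖Δ‖) := mul_le_mul_of_nonneg_left hΔ (by positivity)
  have h3 : 2 * γ * (|Δ k| * ‖Δ‖) ≤ ‖Δ‖ ^ 2 + γ ^ 2 * (Δ k) ^ 2 := by
    nlinarith [sq_nonneg (‖Δ‖ - γ * |Δ k|), sq_abs (Δ k)]
  have h4 : (2 * γ * t * ‖Δ‖) * |Δ k| ≤ (2 * γ * t * ‖Δ‖) * r := by nlinarith [abs_nonneg (Δ k)]
  exact le_of_mul_le_mul_left h4 (by positivity)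

/-- ★ **ISOTROPIC CONFINEMENT**: `λ‖x‖² ≤ Q(x)` for all `x` with `0 < λ`, `0 ≤ t` and `Q(Δ) ≤ t‖Δ‖` give `‖Δ‖ ≤ t/λ`. [folklore] -/
theorem norm_le_of_qfloor {Q : E3 → ℝ} {t lam : ℝ} (ht : 0 ≤ t) (hlam : 0 < lam) (hfloor : ∀ x : E3, lam * ‖x‖ ^ 2 ≤ Q x) {Δ : E3}
    (hΔ : Q Δ ≤ t * ‖Δ‖) : ‖Δ‖ ≤ t / lam := by
  rw [le_div_iff₀ hlam]
  by_cases h0 : Δ = 0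
  · rw [h0, norm_zero, zero_mul]; exact ht
  have hpos : 0 < ‖Δ‖ := norm_pos_iff.2 h0
  have h1 : lam * ‖Δ‖ ^ 2 ≤ t * ‖Δ‖ := (hfloor Δ).trans hΔ
  nlinarith

/-! ## §2. Transfer to ξ-coordinates -/

/-- ★ **ξ-COORDINATES FROM THE DISPLACEMENT**: for `‖U − 1‖ ≤ 1/4`, any `V` and `y` (`= ξ − ξ₀`), `|y_k − (V(Uy))_k| ≤ ‖1 − V∘U‖·(4/3)·‖Uy‖` —
`y − V(Uy) = (1 − V∘U)y` and `‖y‖ ≤ (4/3)‖Uy‖`. [folklore] -/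
theorem abs_coord_sub_le_of_near_one {U : E3 →L[ℝ] E3} (hU : ‖U - 1‖ ≤ 1 / 4) (V : E3 →L[ℝ] E3) (y : E3) (k : Fin 3) :
    |y k - (V (U y)) k| ≤ ‖1 - V.comp U‖ * (4 / 3 * ‖U y‖) := by
  have hrepr : y k - (V (U y)) k = ((1 - V.comp U) y) k := by
    simp
  have h1 : ‖(1 - V.comp U) y‖ ≤ ‖1 - V.comp U‖ * ‖y‖ := (1 - V.comp U).le_opNorm y
  have h34 : (1 - 1 / 4) * ‖y‖ ≤ ‖U y‖ := norm_apply_ge_of_norm_sub_one_le hU y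
  have hy : ‖y‖ ≤ 4 / 3 * ‖U y‖ := by linarith
  have h2 := abs_le.2 (coord_mem_cube_of_norm_le h1 k)
  rw [hrepr]
  exact h2.trans (mul_le_mul_of_nonneg_left hy (norm_nonneg _))

/-- ★ **THE CONFINED ξ-BOX**: `|Δ_j| ≤ r_j` for all `j`, `‖Δ‖ ≤ ρ` (`Δ = U y`, `‖U − 1‖ ≤ 1/4`), the entries `(V e_j)_k` of any `V` and a bound
`κ ≥ ‖1 − V∘U‖` give `|y_k| ≤ Σ_j |(V e_j)_k|·r_j + κ·(4/3)·ρ`. [folklore] -/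
theorem abs_coord_le_of_box {U : E3 →L[ℝ] E3} (hU : ‖U - 1‖ ≤ 1 / 4) (V : E3 →L[ℝ] E3) {κ : ℝ} (hκ : ‖1 - V.comp U‖ ≤ κ) (y : E3)
    {r : Fin 3 → ℝ} (hr : ∀ j : Fin 3, |(U y) j| ≤ r j) {ρ : ℝ} (hρ : ‖U y‖ ≤ ρ) (k : Fin 3) :
    |y k| ≤ ∑ j : Fin 3, |(V (EuclideanSpace.single j (1 : ℝ))) k| * r j + κ * (4 / 3 * ρ) := by
  have h1 := abs_coord_sub_le_of_near_one hU V y k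
  -- `(V Δ)_k = Σ_j (V e_j)_k Δ_j`
  have hexp : (V (U y)) k = ∑ j : Fin 3, (V (EuclideanSpace.single j (1 : ℝ))) k * (U y) j := apply_eq_sum_entries V (U y) k
  have h2 : |(V (U y)) k| ≤ ∑ j : Fin 3, |(V (EuclideanSpace.single j (1 : ℝ))) k| * r j := by
    rw [hexp]
    refine (Finset.abs_sum_le_sum_abs _ _).trans (Finset.sum_le_sum fun j _ => ?_)
    rw [abs_mul]
    exact mul_le_mul_of_nonneg_left (hr j) (abs_nonneg _)
  have h3 : ‖1 - V.comp U‖ * (4 / 3 * ‖U y‖) ≤ κ * (4 / 3 * ρ) :=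
    mul_le_mul hκ (by linarith) (by positivity) ((norm_nonneg _).trans hκ)
  have h4 : |y k| ≤ |y k - (V (U y)) k| + |(V (U y)) k| := by
    have := abs_add_le (y k - (V (U y)) k) ((V (U y)) k)
    rwa [sub_add_cancel] at this
  linarith

end Summit.AtomisticToContinuum.Crystallization.Theorems.FrustratedLawDichotomyStrainedPatchHomSlabConfine
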